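import Literature.AlgebraicGeometry.HodgeTheory.FermatJacobianRingGorenstein
import HarnessLib

/-!
# The Artinian Gorenstein ideal of a (fake) linear cycle on the Fermat variety (Duque Franco–Villaflor 2025, Remark 7.1)

Topic `Literature/AlgebraicGeometry/HodgeTheory`. J. Duque Franco, R. Villaflor Loyola, *Hodge cycles of the
join of algebraic varieties* (arXiv:2312.17222), §7 "Fake algebraic cycles", Remark 7.1: on the Fermat variety
`X = {x_0^d + ⋯ + x_{n+1}^d = 0}` of even dimension `n`, a Hodge cycle `λ` with
`P_λ = c_λ ∏_{j=0}^{n/2} (x_{2j}^{d−1} − (c_j x_{2j+1})^{d−1}) / (x_{2j} − c_j x_{2j+1})`, `c_λ ≠ 0`, has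
Artinian Gorenstein ideal

  `J^{F,λ} = (J^F : P_λ) = ⟨x_0 − c_0 x_1, x_2 − c_1 x_3, …, x_n − c_{n/2} x_{n+1}, x_0^{d−1}, …, x_{n+1}^{d−1}⟩`
  (eq. (eqAGfakelcFermat), p. 18), "which in turn implies that `HF_λ = HF_{[ℙ^{n/2}]}`"; "In the case where all
  `c_j` are `d`-th roots of `−1`, `λ` corresponds to the class of a linear cycle in Fermat. In all other cases
  `λ` is a fake linear cycle"; and `R^{F,λ} = ⊗_j R^{F_j,λ_j}` with the `0`-dimensional factors
  `P_{λ_j} = (x_{2j}^{d−1} − (c_j x_{2j+1})^{d−1}) / (x_{2j} − c_j x_{2j+1})` (proof of Thm. 1.5, p. 19: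
  "`J^{F,δ} = (J^F : P) = ⟨x_0 − c x_1, x_0^{d−1}, x_1^{d−1}⟩` and so `HF_δ = HF_{[p_i]}`").

**What this file proves** (all PROVED, 0 facts), purely algebraically, over any field `K`, for any exponent
`e = d − 1 ≥ 1` and ANY scalars `c_j ∈ K` — the variables are indexed by `τ ⊕ τ` with the dictionary
`Sum.inl j ↔ x_{2j}`, `Sum.inr j ↔ x_{2j+1}` (`#τ = n/2 + 1` pairs), `J = (x_i^e : i ∈ τ ⊕ τ)` is the Jacobian
ideal of the Fermat polynomial of degree `e + 1` (tree `jacobianIdeal_fermatPolynomial`, up to this re-indexing):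

* `span_X_pow_colon_fermatLinearCyclePolynomial` / `…_C_mul_…`: eq. (eqAGfakelcFermat),
  `(J : c_λ P) = ⟨x_{2j} − c_j x_{2j+1}, x_i^e⟩ =: fermatLinearCycleIdeal c e` for every `c_λ ≠ 0`;
* `isArtinianGorenstein_fermatLinearCycleIdeal`: that ideal is Artinian Gorenstein of socle `#τ·(e−1)`
  `= (d−2)(n/2+1)`, being the annihilator `annIdeal` of the functional
  `ℓ_λ(g) = coeff_{∏ y_j^{e−1}} g(c_j y_j, y_j)` (restriction to the linear subspace followed by the socle
  functional of the `0`-cycle factors — the tensor decomposition `R^{F,λ} = ⊗_j R^{F_j,λ_j}`);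
* `hilbert_fermatLinearCycleIdeal_eq_card`: "`HF_λ = HF_{[ℙ^{n/2}]}`" in the explicit form
  `dim (S/J^{F,λ})_a = #{β ∈ [0, d−2]^{n/2+1} : |β| = a}` (the Hilbert function of `(y_j^e) ⊂ K[y_j : j ∈ τ]`,
  Movasati's box count in HALF the variables; e.g. `a = d`: `binom(n/2+d, d) − (n/2+1)²`).

Method: `fermatLinearCycleIdeal ⊆ (J : P)` by the displayed factorisation
`(x_{2j} − c_j x_{2j+1}) · P_{λ_j} = x_{2j}^e − c_j^e x_{2j+1}^e ∈ J` (`geom_sum₂_mul`); both sides are Artinian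
Gorenstein of the same socle (`IsArtinianGorenstein.colon`, and the inverse-system description above), hence
equal (`IsArtinianGorenstein.colon_eq_of_le`). The transcendental input "`P_λ` of this shape represents the
(fake) linear cycle `λ`" (Movasati–Villaflor; Griffiths' residues) is NOT formalised: every statement here is
about the ideal quotient `(J : P)` of the explicit polynomial `P`.
-/

noncomputable section

open MvPolynomial Module Literature.RingTheory.MvPolynomial Literature.AlgebraicGeometry.Kloosterman2025
  Literature.AlgebraicGeometry.DuqueFrancoVillaflor2025

attribute [local instance] MvPolynomial.gradedAlgebra

namespace Literature.AlgebraicGeometry.HodgeTheory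

variable {K : Type*} [Field K] {τ : Type*}

section Definitions

variable (c : τ → K) (e : ℕ)

/-- The `0`-dimensional factor `P_{λ_j} = (x_{2j}^e − (c_j x_{2j+1})^e) / (x_{2j} − c_j x_{2j+1})`
`= Σ_{l<e} x_{2j}^l (c_j x_{2j+1})^{e−1−l}` (`e = d − 1`; `Sum.inl j ↔ x_{2j}`, `Sum.inr j ↔ x_{2j+1}`).
[cite: DuqueFrancoVillaflor2025Join, Remark 7.1] -/
def fermatLinearCycleFactor (j : τ) : MvPolynomial (τ ⊕ τ) K :=
  ∑ l ∈ Finset.range e,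
    (X (Sum.inl j) : MvPolynomial (τ ⊕ τ) K) ^ l * (C (c j) * X (Sum.inr j)) ^ (e - 1 - l)

/-- The polynomial `P_λ / c_λ = ∏_j (x_{2j}^e − (c_j x_{2j+1})^e) / (x_{2j} − c_j x_{2j+1})` of a (fake) linear
cycle on the Fermat variety of degree `e + 1` (a genuine linear cycle when all `c_j^{e+1} = −1`).
[cite: DuqueFrancoVillaflor2025Join, Remark 7.1] -/
def fermatLinearCyclePolynomial [Fintype τ] : MvPolynomial (τ ⊕ τ) K :=
  ∏ j : τ, fermatLinearCycleFactor c e j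

/-- The ideal `⟨x_{2j} − c_j x_{2j+1} (j ∈ τ), x_i^e (i ∈ τ ⊕ τ)⟩` — the right-hand side of
eq. (eqAGfakelcFermat). [cite: DuqueFrancoVillaflor2025Join, Remark 7.1, eq. (eqAGfakelcFermat)] -/
def fermatLinearCycleIdeal : Ideal (MvPolynomial (τ ⊕ τ) K) :=
  Ideal.span ((Set.range fun j : τ => (X (Sum.inl j) : MvPolynomial (τ ⊕ τ) K) - C (c j) * X (Sum.inr j)) ∪
    Set.range fun i : τ ⊕ τ => (X i : MvPolynomial (τ ⊕ τ) K) ^ e)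

/-- Restriction to the linear subspace `{x_{2j} = c_j x_{2j+1}} ≅ ℙ^{n/2}` with coordinates `y_j = x_{2j+1}`:
the substitution `x_{2j} ↦ c_j y_j`, `x_{2j+1} ↦ y_j`. [cite: DuqueFrancoVillaflor2025Join, Remark 7.1] -/
def fermatLinearCycleSubst : MvPolynomial (τ ⊕ τ) K →ₐ[K] MvPolynomial τ K :=
  aeval (Sum.elim (fun j => C (c j) * X j) X)

/-- The generator of the inverse system of `J^{F,λ}`: `ℓ_λ(g) =` coefficient of `∏_j y_j^{e−1}` in
`g(c_j y_j, y_j)` — the socle functional of `⊗_j R^{F_j,λ_j}` pulled back along the restriction.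
[cite: DuqueFrancoVillaflor2025Join, Remark 7.1] [cite: IarrobinoKanev1999, Lemma 2.14] -/
def fermatLinearCycleFunctional [Finite τ] : MvPolynomial (τ ⊕ τ) K →ₗ[K] K :=
  fermatSocleFunctional K τ e ∘ₗ (fermatLinearCycleSubst c).toLinearMap

end Definitions

variable (c : τ → K) (e : ℕ)

/-! ## The substitution `x_{2j} ↦ c_j y_j`, `x_{2j+1} ↦ y_j` -/

/-- `x_{2j} ↦ c_j y_j`. [cite: DuqueFrancoVillaflor2025Join, Remark 7.1] -/
@[simp] theorem fermatLinearCycleSubst_X_inl (j : τ) :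
    fermatLinearCycleSubst c (X (Sum.inl j)) = C (c j) * X j := by
  simp [fermatLinearCycleSubst]

/-- `x_{2j+1} ↦ y_j`. [cite: DuqueFrancoVillaflor2025Join, Remark 7.1] -/
@[simp] theorem fermatLinearCycleSubst_X_inr (j : τ) :
    fermatLinearCycleSubst c (X (Sum.inr j)) = X j := by
  simp [fermatLinearCycleSubst]

/-- Constants are fixed. [cite: DuqueFrancoVillaflor2025Join, Remark 7.1] -/
@[simp] theorem fermatLinearCycleSubst_C (a : K) : fermatLinearCycleSubst c (C a) = C a := by
  rw [fermatLinearCycleSubst, aeval_C, MvPolynomial.algebraMap_eq]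

/-- The inclusion `y_j ↦ x_{2j+1}` is a section of the restriction. [cite: DuqueFrancoVillaflor2025Join, Remark 7.1] -/
@[simp] theorem fermatLinearCycleSubst_rename_inr (q : MvPolynomial τ K) :
    fermatLinearCycleSubst c (rename Sum.inr q) = q := by
  rw [fermatLinearCycleSubst, aeval_rename, Sum.elim_comp_inr, aeval_X_left_apply]

/-- The restriction is surjective. [cite: DuqueFrancoVillaflor2025Join, Remark 7.1] -/
theorem fermatLinearCycleSubst_surjective : Function.Surjective (fermatLinearCycleSubst c) :=
  fun q => ⟨rename Sum.inr q, fermatLinearCycleSubst_rename_inr c q⟩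

/-- `g ≡ g(c_j x_{2j+1}, x_{2j+1})` modulo the linear equations `x_{2j} − c_j x_{2j+1}` (the two algebra maps
`S → S/⟨x_{2j} − c_j x_{2j+1}⟩` agree on the variables). [cite: DuqueFrancoVillaflor2025Join, Remark 7.1] -/
theorem sub_rename_fermatLinearCycleSubst_mem (g : MvPolynomial (τ ⊕ τ) K) :
    g - rename Sum.inr (fermatLinearCycleSubst c g) ∈
      Ideal.span (Set.range fun j : τ => (X (Sum.inl j) : MvPolynomial (τ ⊕ τ) K) - C (c j) * X (Sum.inr j)) := by
  rw [← Ideal.Quotient.eq]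
  have key : Ideal.Quotient.mkₐ K (Ideal.span (Set.range fun j : τ =>
        (X (Sum.inl j) : MvPolynomial (τ ⊕ τ) K) - C (c j) * X (Sum.inr j))) =
      (Ideal.Quotient.mkₐ K _).comp
        ((rename Sum.inr : MvPolynomial τ K →ₐ[K] MvPolynomial (τ ⊕ τ) K).comp (fermatLinearCycleSubst c)) := by
    refine MvPolynomial.algHom_ext fun i => ?_
    rcases i with j | j
    · rw [AlgHom.comp_apply, AlgHom.comp_apply, fermatLinearCycleSubst_X_inl, map_mul, rename_C, rename_X,
        Ideal.Quotient.mkₐ_eq_mk, Ideal.Quotient.eq]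
      exact Ideal.subset_span ⟨j, rfl⟩
    · rw [AlgHom.comp_apply, AlgHom.comp_apply, fermatLinearCycleSubst_X_inr, rename_X]
  have h := congrArg (fun f => f g) key
  simpa only [AlgHom.comp_apply, Ideal.Quotient.mkₐ_eq_mk] using h

/-- The restriction preserves degrees (a substitution by linear forms). [cite: DuqueFrancoVillaflor2025Join, Remark 7.1] -/
theorem isHomogeneous_fermatLinearCycleSubst {g : MvPolynomial (τ ⊕ τ) K} {i : ℕ} (hg : g.IsHomogeneous i) :
    (fermatLinearCycleSubst c g).IsHomogeneous i := by
  have hhom : ∀ k : τ ⊕ τ, (Sum.elim (fun j => C (c j) * X j) X k : MvPolynomial τ K).IsHomogeneous 1 := by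
    rintro (j | j)
    · exact (isHomogeneous_X K j).C_mul (c j)
    · exact isHomogeneous_X K j
  have h := hg.aeval _ hhom
  rw [one_mul] at h
  exact h

/-! ## The inverse system `ℓ_λ` and `Ann(ℓ_λ) = ⟨x_{2j} − c_j x_{2j+1}, x_i^e⟩` -/

/-- `ℓ_λ(g) = coeff_{β₀}(g(c_j y_j, y_j))`, `β₀ = (e−1, …, e−1)`. [cite: DuqueFrancoVillaflor2025Join, Remark 7.1] -/
@[simp] theorem fermatLinearCycleFunctional_apply [Finite τ] (g : MvPolynomial (τ ⊕ τ) K) :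
    fermatLinearCycleFunctional c e g = coeff (fermatSocleExponent τ e) (fermatLinearCycleSubst c g) := by
  simp [fermatLinearCycleFunctional]

/-- `ℓ_λ` is concentrated in degree `#τ·(e−1) = (d−2)(n/2+1)` (the socle degree of `J^{F,λ}`).
[cite: DuqueFrancoVillaflor2025Join, Remark 7.1, Definition 2.2] -/
theorem fermatLinearCycleFunctional_homogeneousComponent [Fintype τ] (p : MvPolynomial (τ ⊕ τ) K) :
    fermatLinearCycleFunctional c e (homogeneousComponent (Fintype.card τ * (e - 1)) p) =
      fermatLinearCycleFunctional c e p := by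
  have hvan : ∀ i, i ≠ Fintype.card τ * (e - 1) →
      fermatLinearCycleFunctional c e (homogeneousComponent i p) = 0 := by
    intro i hi
    rw [fermatLinearCycleFunctional_apply]
    exact (isHomogeneous_fermatLinearCycleSubst c (homogeneousComponent_isHomogeneous i p)).coeff_eq_zero
      (by rw [degree_fermatSocleExponent]; exact Ne.symm hi)
  conv_rhs => rw [← sum_homogeneousComponent p, map_sum]
  rw [Finset.sum_eq_single (Fintype.card τ * (e - 1)) (fun i _ hi => hvan i hi) fun hN => ?_]
  rw [Finset.mem_range, not_lt] at hN
  rw [homogeneousComponent_eq_zero (Fintype.card τ * (e - 1)) p (by omega), map_zero]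

/-- `ℓ_λ ≠ 0`: `ℓ_λ(∏ x_{2j+1}^{e−1}) = 1`. [cite: DuqueFrancoVillaflor2025Join, Remark 7.1] -/
theorem fermatLinearCycleFunctional_ne_zero [Finite τ] : fermatLinearCycleFunctional c e ≠ 0 := by
  classical
  intro h
  have h1 := LinearMap.congr_fun h (rename Sum.inr (monomial (fermatSocleExponent τ e) (1 : K)))
  rw [fermatLinearCycleFunctional_apply, fermatLinearCycleSubst_rename_inr, coeff_monomial, if_pos rfl,
    LinearMap.zero_apply] at h1
  exact one_ne_zero h1

/-- `⟨x_{2j} − c_j x_{2j+1}, x_i^e⟩ ⊆ Ann(ℓ_λ)`: the linear generators restrict to `0`, and `x_i^e` restricts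
into `(y_j^e)`, on which the socle functional vanishes. [cite: DuqueFrancoVillaflor2025Join, Remark 7.1] -/
theorem fermatLinearCycleIdeal_le_annIdeal [Finite τ] (he : 1 ≤ e) :
    fermatLinearCycleIdeal c e ≤ annIdeal (fermatLinearCycleFunctional c e) := by
  refine Ideal.span_le.mpr ?_
  rintro _ (⟨j, rfl⟩ | ⟨i, rfl⟩)
  · rw [SetLike.mem_coe, mem_annIdeal_iff]
    intro h
    rw [fermatLinearCycleFunctional_apply, map_mul, map_sub, map_mul, fermatLinearCycleSubst_C,
      fermatLinearCycleSubst_X_inl, fermatLinearCycleSubst_X_inr, sub_self, zero_mul, coeff_zero]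
  · rw [SetLike.mem_coe, mem_annIdeal_iff]
    intro h
    rw [fermatLinearCycleFunctional_apply, map_mul, map_pow, ← fermatSocleFunctional_apply]
    refine fermatSocleFunctional_eq_zero_of_mem he (Ideal.mul_mem_right _ _ ?_)
    rcases i with j | j
    · rw [fermatLinearCycleSubst_X_inl, mul_pow]
      exact Ideal.mul_mem_left _ _ (Ideal.subset_span ⟨j, rfl⟩)
    · rw [fermatLinearCycleSubst_X_inr]
      exact Ideal.subset_span ⟨j, rfl⟩

/-- **`Ann(ℓ_λ) = ⟨x_{2j} − c_j x_{2j+1}, x_i^e⟩`** (`e ≥ 1`): modulo the linear equations every `g` is a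
polynomial in the `x_{2j+1}` alone, and there the annihilator of the socle functional is `(x_{2j+1}^e)`
(Iarrobino–Kanev Example 5.8, tree `annIdeal_fermatSocleFunctional`) — the tensor decomposition
`R^{F,λ} = ⊗_j R^{F_j,λ_j}`, `R^{F_j,λ_j} = K[y]/(y^e)`. [cite: DuqueFrancoVillaflor2025Join, Remark 7.1]
[cite: IarrobinoKanev1999, Example 5.8] -/
theorem annIdeal_fermatLinearCycleFunctional [Finite τ] (he : 1 ≤ e) :
    annIdeal (fermatLinearCycleFunctional c e) = fermatLinearCycleIdeal c e := by
  refine le_antisymm (fun g hg => ?_) (fermatLinearCycleIdeal_le_annIdeal c e he)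
  have h1 : g - rename Sum.inr (fermatLinearCycleSubst c g) ∈ fermatLinearCycleIdeal c e :=
    Ideal.span_mono Set.subset_union_left (sub_rename_fermatLinearCycleSubst_mem c g)
  have h2 : fermatLinearCycleSubst c g ∈ Ideal.span (Set.range fun j : τ => (X j : MvPolynomial τ K) ^ e) := by
    rw [← annIdeal_fermatSocleFunctional he, mem_annIdeal_iff]
    intro h'
    have h3 := hg (rename Sum.inr h')
    rwa [fermatLinearCycleFunctional_apply, map_mul, fermatLinearCycleSubst_rename_inr,
      ← fermatSocleFunctional_apply] at h3
  have h3 : rename Sum.inr (fermatLinearCycleSubst c g) ∈ fermatLinearCycleIdeal c e := by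
    have hmap := Ideal.mem_map_of_mem
      (rename (Sum.inr : τ → τ ⊕ τ) : MvPolynomial τ K →ₐ[K] MvPolynomial (τ ⊕ τ) K) h2
    rw [Ideal.map_span] at hmap
    refine Ideal.span_le.mpr ?_ hmap
    rintro _ ⟨_, ⟨j, rfl⟩, rfl⟩
    rw [SetLike.mem_coe, map_pow, rename_X]
    exact Ideal.subset_span (Or.inr ⟨Sum.inr j, rfl⟩)
  have h4 := (fermatLinearCycleIdeal c e).add_mem h1 h3
  rwa [sub_add_cancel] at h4

/-- **`⟨x_{2j} − c_j x_{2j+1}, x_i^e⟩` is Artinian Gorenstein of socle `#τ·(e−1) = (d−2)(n/2+1)`** — it is the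
annihilator ideal of the non-zero functional `ℓ_λ` concentrated in that degree.
[cite: DuqueFrancoVillaflor2025Join, Remark 7.1, Definition 2.2] -/
theorem isArtinianGorenstein_fermatLinearCycleIdeal [Fintype τ] (he : 1 ≤ e) :
    IsArtinianGorenstein (fermatLinearCycleIdeal c e) (Fintype.card τ * (e - 1)) := by
  rw [← annIdeal_fermatLinearCycleFunctional c e he]
  exact isArtinianGorenstein_annIdeal (fermatLinearCycleFunctional_homogeneousComponent c e)
    (fermatLinearCycleFunctional_ne_zero c e)

/-! ## The polynomial `P_λ` -/

/-- The displayed quotient: `(x_{2j} − c_j x_{2j+1}) · P_{λ_j} = x_{2j}^e − (c_j x_{2j+1})^e`.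
[cite: DuqueFrancoVillaflor2025Join, Remark 7.1] -/
theorem X_sub_C_mul_X_mul_fermatLinearCycleFactor (j : τ) :
    ((X (Sum.inl j) : MvPolynomial (τ ⊕ τ) K) - C (c j) * X (Sum.inr j)) * fermatLinearCycleFactor c e j =
      X (Sum.inl j) ^ e - (C (c j) * X (Sum.inr j)) ^ e := by
  rw [mul_comm, fermatLinearCycleFactor, geom_sum₂_mul]

/-- `P_{λ_j}` is a form of degree `e − 1`. [cite: DuqueFrancoVillaflor2025Join, Remark 7.1] -/
theorem isHomogeneous_fermatLinearCycleFactor (j : τ) : (fermatLinearCycleFactor c e j).IsHomogeneous (e - 1) := by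
  refine IsHomogeneous.sum _ _ _ fun l hl => ?_
  have hl' : l + 1 * (e - 1 - l) = e - 1 := by
    rw [Finset.mem_range] at hl
    omega
  have h := (isHomogeneous_X_pow (R := K) (Sum.inl j : τ ⊕ τ) l).mul
    (((isHomogeneous_X K (Sum.inr j : τ ⊕ τ)).C_mul (c j)).pow (e - 1 - l))
  rwa [hl'] at h

/-- `P_λ` is a form of degree `#τ·(e−1) = (d−2)(n/2+1)` (half the socle degree of `J^F`).
[cite: DuqueFrancoVillaflor2025Join, Remark 7.1, Proposition 2.2] -/
theorem isHomogeneous_fermatLinearCyclePolynomial [Fintype τ] :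
    (fermatLinearCyclePolynomial c e).IsHomogeneous (Fintype.card τ * (e - 1)) := by
  have h : (fermatLinearCyclePolynomial c e).IsHomogeneous (∑ _j : τ, (e - 1)) :=
    IsHomogeneous.prod _ _ _ fun j _ => isHomogeneous_fermatLinearCycleFactor c e j
  rwa [Finset.sum_const, Finset.card_univ, smul_eq_mul] at h

/-- `P_λ ∉ J^F` (`e ≥ 1`): under `x_{2j} ↦ y_j`, `x_{2j+1} ↦ 0` the ideal `J` goes into `(y_j^e)` while `P_λ`
goes to the socle monomial `∏ y_j^{e−1} ∉ (y_j^e)` (tree `prod_X_pow_not_mem_span_X_pow`).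
[cite: DuqueFrancoVillaflor2025Join, Remark 7.1] [cite: VoisinHodgeII2003, Thm. 6.19] -/
theorem fermatLinearCyclePolynomial_not_mem [Fintype τ] (he : 1 ≤ e) :
    fermatLinearCyclePolynomial c e ∉
      Ideal.span (Set.range fun i : τ ⊕ τ => (X i : MvPolynomial (τ ⊕ τ) K) ^ e) := by
  intro hP
  have hle : Ideal.span (Set.range fun i : τ ⊕ τ => (X i : MvPolynomial (τ ⊕ τ) K) ^ e) ≤
      (Ideal.span (Set.range fun j : τ => (X j : MvPolynomial τ K) ^ e)).comap
        (aeval (Sum.elim X 0) : MvPolynomial (τ ⊕ τ) K →ₐ[K] MvPolynomial τ K) := by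
    refine Ideal.span_le.mpr ?_
    rintro _ ⟨i, rfl⟩
    rw [SetLike.mem_coe, Ideal.mem_comap, map_pow]
    rcases i with j | j
    · rw [aeval_X, Sum.elim_inl]
      exact Ideal.subset_span ⟨j, rfl⟩
    · rw [aeval_X, Sum.elim_inr, Pi.zero_apply, zero_pow (by omega)]
      exact zero_mem _
  have hP' := hle hP
  rw [Ideal.mem_comap] at hP'
  have hφP : (aeval (Sum.elim X 0) : MvPolynomial (τ ⊕ τ) K →ₐ[K] MvPolynomial τ K)
      (fermatLinearCyclePolynomial c e) = ∏ j : τ, (X j : MvPolynomial τ K) ^ (e - 1) := by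
    rw [fermatLinearCyclePolynomial, map_prod]
    refine Finset.prod_congr rfl fun j _ => ?_
    rw [fermatLinearCycleFactor, map_sum,
      Finset.sum_eq_single_of_mem (e - 1) (Finset.mem_range.mpr (by omega))]
    · rw [map_mul, map_pow, map_pow, aeval_X, Sum.elim_inl, Nat.sub_self, pow_zero, mul_one]
    · intro l hl hne
      rw [Finset.mem_range] at hl
      rw [map_mul, map_pow, map_pow, map_mul, aeval_X, aeval_X, Sum.elim_inr, Pi.zero_apply, mul_zero,
        zero_pow (by omega), mul_zero]
  rw [hφP] at hP'
  exact prod_X_pow_not_mem_span_X_pow he hP'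

/-- **`⟨x_{2j} − c_j x_{2j+1}, x_i^e⟩ ⊆ (J : P_λ)`**: `(x_{2j} − c_j x_{2j+1}) P_λ = (x_{2j}^e − c_j^e x_{2j+1}^e) ·
∏_{j' ≠ j} P_{λ_{j'}} ∈ J` and `x_i^e P_λ ∈ J`. [cite: DuqueFrancoVillaflor2025Join, Remark 7.1] -/
theorem fermatLinearCycleIdeal_le_colon [Fintype τ] :
    fermatLinearCycleIdeal c e ≤
      (Ideal.span (Set.range fun i : τ ⊕ τ => (X i : MvPolynomial (τ ⊕ τ) K) ^ e)).colon
        {fermatLinearCyclePolynomial c e} := by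
  classical
  refine Ideal.span_le.mpr ?_
  rintro _ (⟨j, rfl⟩ | ⟨i, rfl⟩)
  · rw [SetLike.mem_coe, Submodule.mem_colon_singleton, smul_eq_mul, fermatLinearCyclePolynomial,
      ← Finset.mul_prod_erase Finset.univ (fermatLinearCycleFactor c e) (Finset.mem_univ j), ← mul_assoc,
      X_sub_C_mul_X_mul_fermatLinearCycleFactor]
    refine Ideal.mul_mem_right _ _ (Ideal.sub_mem _ (Ideal.subset_span ⟨Sum.inl j, rfl⟩) ?_)
    rw [mul_pow]
    exact Ideal.mul_mem_left _ _ (Ideal.subset_span ⟨Sum.inr j, rfl⟩)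
  · rw [SetLike.mem_coe, Submodule.mem_colon_singleton, smul_eq_mul]
    exact Ideal.mul_mem_right _ _ (Ideal.subset_span ⟨i, rfl⟩)

/-! ## Eq. (eqAGfakelcFermat): `J^{F,λ} = (J^F : P_λ) = ⟨x_{2j} − c_j x_{2j+1}, x_i^{d−1}⟩` -/

/-- **Duque Franco–Villaflor, Remark 7.1, eq. (eqAGfakelcFermat)** (`e = d − 1 ≥ 1`, any `c_j ∈ K`):
`(J^F : P_λ) = ⟨x_0 − c_0 x_1, x_2 − c_1 x_3, …, x_n − c_{n/2} x_{n+1}, x_0^{d−1}, …, x_{n+1}^{d−1}⟩` for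
`P_λ = ∏_j (x_{2j}^{d−1} − (c_j x_{2j+1})^{d−1}) / (x_{2j} − c_j x_{2j+1})` — both sides are Artinian Gorenstein of
socle `(d−2)(n/2+1)` and one contains the other. For `n = 0` this is "`J^{F,δ} = (J^F : P) = ⟨x_0 − c x_1,
x_0^{d−1}, x_1^{d−1}⟩`" of the proof of Thm. 1.5. [cite: DuqueFrancoVillaflor2025Join, Remark 7.1, eq. (eqAGfakelcFermat); §7, proof of Thm. 1.5] -/
theorem span_X_pow_colon_fermatLinearCyclePolynomial [Fintype τ] (he : 1 ≤ e) :
    (Ideal.span (Set.range fun i : τ ⊕ τ => (X i : MvPolynomial (τ ⊕ τ) K) ^ e)).colon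
        {fermatLinearCyclePolynomial c e} = fermatLinearCycleIdeal c e :=
  (isArtinianGorenstein_span_X_pow he).colon_eq_of_le (isHomogeneous_fermatLinearCyclePolynomial c e)
    (by rw [Fintype.card_sum]; ring) (fermatLinearCyclePolynomial_not_mem c e he)
    (isArtinianGorenstein_fermatLinearCycleIdeal c e he) (fermatLinearCycleIdeal_le_colon c e)

/-- Ideal quotients by a form do not see a non-zero constant factor `c_λ`: `(I : c_λ P) = (I : P)`.
[cite: DuqueFrancoVillaflor2025Join, Proposition 2.2, Definition 2.2] -/
theorem colon_singleton_C_mul {σ' : Type*} (I : Ideal (MvPolynomial σ' K)) {a : K} (ha : a ≠ 0)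
    (P : MvPolynomial σ' K) : I.colon {C a * P} = I.colon {P} := by
  ext g
  rw [Submodule.mem_colon_singleton, Submodule.mem_colon_singleton, smul_eq_mul, smul_eq_mul,
    mul_left_comm]
  exact Ideal.unit_mul_mem_iff_mem I ((isUnit_iff_ne_zero.mpr ha).map C)

/-- Eq. (eqAGfakelcFermat) with the constant `c_λ ≠ 0`: `(J^F : c_λ ∏_j P_{λ_j}) = ⟨x_{2j} − c_j x_{2j+1}, x_i^e⟩`.
[cite: DuqueFrancoVillaflor2025Join, Remark 7.1, eq. (eqAGfakelcFermat)] -/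
theorem span_X_pow_colon_C_mul_fermatLinearCyclePolynomial [Fintype τ] (he : 1 ≤ e) {a : K} (ha : a ≠ 0) :
    (Ideal.span (Set.range fun i : τ ⊕ τ => (X i : MvPolynomial (τ ⊕ τ) K) ^ e)).colon
        {C a * fermatLinearCyclePolynomial c e} = fermatLinearCycleIdeal c e := by
  rw [colon_singleton_C_mul _ ha, span_X_pow_colon_fermatLinearCyclePolynomial c e he]

/-- `J^{F,λ} = (J^F : c_λ P_λ)` is Artinian Gorenstein of socle `(d−2)(n/2+1) = #τ·(e−1)` (Def. 2.2 for the
(fake) linear cycles of the Fermat variety, unconditionally). [cite: DuqueFrancoVillaflor2025Join, Definition 2.2, Remark 7.1] -/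
theorem isArtinianGorenstein_span_X_pow_colon_fermatLinearCyclePolynomial [Fintype τ] (he : 1 ≤ e) {a : K}
    (ha : a ≠ 0) :
    IsArtinianGorenstein ((Ideal.span (Set.range fun i : τ ⊕ τ => (X i : MvPolynomial (τ ⊕ τ) K) ^ e)).colon
        {C a * fermatLinearCyclePolynomial c e}) (Fintype.card τ * (e - 1)) := by
  rw [span_X_pow_colon_C_mul_fermatLinearCyclePolynomial c e he ha]
  exact isArtinianGorenstein_fermatLinearCycleIdeal c e he

/-! ## `HF_λ = HF_{[ℙ^{n/2}]}` -/

/-- **"which in turn implies that `HF_λ = HF_{[ℙ^{n/2}]}`"**: the Hilbert function of `S/J^{F,λ}` is that of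
`K[y_j : j ∈ τ]/(y_j^e)` — the pairing `S_a/J^{F,λ}_a × S_b/J^{F,λ}_b → K` is pulled back from the perfect pairing
of `K[y]/(y_j^e)` along the (surjective) restriction, so the ranks agree. [cite: DuqueFrancoVillaflor2025Join, Remark 7.1] -/
theorem hilbert_fermatLinearCycleIdeal_eq [Fintype τ] (he : 1 ≤ e) (a : ℕ) :
    finrank K (homogeneousSubmodule (τ ⊕ τ) K a) - finrank K (idealDegree (fermatLinearCycleIdeal c e) a) =
      finrank K (homogeneousSubmodule τ K a) -
        finrank K (idealDegree (Ideal.span (Set.range fun j : τ => (X j : MvPolynomial τ K) ^ e)) a) := by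
  rw [← annIdeal_fermatLinearCycleFunctional c e he, ← annIdeal_fermatSocleFunctional he]
  have hℓ' := fermatLinearCycleFunctional_homogeneousComponent c e
  have hℓ := fermatSocleFunctional_homogeneousComponent (K := K) (ι := τ) (e := e)
  by_cases ha : a ≤ Fintype.card τ * (e - 1)
  · obtain ⟨b, hab⟩ : ∃ b, a + b = Fintype.card τ * (e - 1) := ⟨_, Nat.add_sub_cancel' ha⟩
    rw [← finrank_range_gradedMulForm hℓ' hab, ← finrank_range_gradedMulForm hℓ hab]
    -- the restriction on graded pieces, surjective with section `rename inr`
    let Φ : ∀ i : ℕ, homogeneousSubmodule (τ ⊕ τ) K i →ₗ[K] homogeneousSubmodule τ K i := fun i =>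
      (fermatLinearCycleSubst c).toLinearMap.restrict fun x hx =>
        (mem_homogeneousSubmodule i _).mpr
          (isHomogeneous_fermatLinearCycleSubst c ((mem_homogeneousSubmodule i x).mp hx))
    have hΦ_apply : ∀ (i : ℕ) (x : homogeneousSubmodule (τ ⊕ τ) K i),
        (Φ i x : MvPolynomial τ K) = fermatLinearCycleSubst c x := fun i x => rfl
    have hΦ_surj : ∀ i, Function.Surjective (Φ i) := by
      intro i y
      refine ⟨⟨rename Sum.inr (y : MvPolynomial τ K),
        (mem_homogeneousSubmodule i _).mpr ((mem_homogeneousSubmodule i _).mp y.2).rename_isHomogeneous⟩, ?_⟩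
      exact Subtype.ext (by rw [hΦ_apply, fermatLinearCycleSubst_rename_inr])
    have hfact : gradedMulForm (fermatLinearCycleFunctional c e) a b =
        (LinearMap.lcomp K K (Φ b) ∘ₗ gradedMulForm (fermatSocleFunctional K τ e) a b) ∘ₗ Φ a := by
      refine LinearMap.ext fun g => LinearMap.ext fun h => ?_
      rw [gradedMulForm_apply, LinearMap.comp_apply, LinearMap.comp_apply, LinearMap.lcomp_apply,
        gradedMulForm_apply, hΦ_apply, hΦ_apply, ← map_mul, fermatLinearCycleFunctional_apply,
        fermatSocleFunctional_apply]
    have hinj : Function.Injective (LinearMap.lcomp K K (Φ b) :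
        (homogeneousSubmodule τ K b →ₗ[K] K) →ₗ[K] homogeneousSubmodule (τ ⊕ τ) K b →ₗ[K] K) := by
      intro f₁ f₂ hf
      refine LinearMap.ext fun y => ?_
      obtain ⟨x, rfl⟩ := hΦ_surj b y
      have := LinearMap.congr_fun hf x
      rwa [LinearMap.lcomp_apply, LinearMap.lcomp_apply] at this
    rw [hfact, LinearMap.range_comp_of_range_eq_top _ (LinearMap.range_eq_top.mpr (hΦ_surj a)),
      LinearMap.range_comp]
    exact ((Submodule.equivMapOfInjective _ hinj _).finrank_eq).symm
  · push Not at ha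
    rw [hilbert_annIdeal_eq_zero_of_lt hℓ' ha, hilbert_annIdeal_eq_zero_of_lt hℓ ha]

/-- **`HF_λ(a) = HF_{[ℙ^{n/2}]}(a) = #{β ∈ ℕ^{n/2+1} : 0 ≤ β_j ≤ d−2, |β| = a}`** — Movasati's box count in the
`n/2 + 1` variables `y_j` (e.g. `HF_λ(d) = binom(n/2+d, d) − (n/2+1)²`, the value singled out in Remark 7.1).
[cite: DuqueFrancoVillaflor2025Join, Remark 7.1] [cite: Movasati2016Periods, Definition 1] -/
theorem hilbert_fermatLinearCycleIdeal_eq_card [Fintype τ] [DecidableEq τ] (he : 1 ≤ e) (a : ℕ) :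
    finrank K (homogeneousSubmodule (τ ⊕ τ) K a) - finrank K (idealDegree (fermatLinearCycleIdeal c e) a) =
      (Finset.filter (fun β : τ →₀ ℕ => ∀ j, β j ≤ e - 1)
        ((Finset.univ : Finset τ).finsuppAntidiag a : Finset (τ →₀ ℕ))).card := by
  rw [hilbert_fermatLinearCycleIdeal_eq c e he a]
  convert hilbert_span_X_pow_eq_card (K := K) (ι := τ) he a

/-- The same for `J^{F,λ} = (J^F : c_λ P_λ)` itself: `dim (S/(J^F : c_λ P_λ))_a = #{β ∈ [0,d−2]^{n/2+1} : |β| = a}`.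
[cite: DuqueFrancoVillaflor2025Join, Remark 7.1] -/
theorem hilbert_span_X_pow_colon_fermatLinearCyclePolynomial_eq_card [Fintype τ] [DecidableEq τ] (he : 1 ≤ e)
    {a₀ : K} (ha₀ : a₀ ≠ 0) (a : ℕ) :
    finrank K (homogeneousSubmodule (τ ⊕ τ) K a) -
        finrank K (idealDegree ((Ideal.span (Set.range fun i : τ ⊕ τ => (X i : MvPolynomial (τ ⊕ τ) K) ^ e)).colon
          {C a₀ * fermatLinearCyclePolynomial c e}) a) =
      (Finset.filter (fun β : τ →₀ ℕ => ∀ j, β j ≤ e - 1)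
        ((Finset.univ : Finset τ).finsuppAntidiag a : Finset (τ →₀ ℕ))).card := by
  rw [span_X_pow_colon_C_mul_fermatLinearCyclePolynomial c e he ha₀]
  exact hilbert_fermatLinearCycleIdeal_eq_card c e he a

end Literature.AlgebraicGeometry.HodgeTheory

end
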